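import Summits.BirchSwinnertonDyer.BirchSwinnertonDyer.Theorems.QuadraticBranchSignedControlPlusEtaNonsurjFineRoadAnchor
import Summits.BirchSwinnertonDyer.Rank1Residual.X11b.KrausMinimalityGeneralTwo
import Summits.BirchSwinnertonDyer.Rank1Residual.X11b.ChaPairsMinimality
import HarnessLib

/-!
# Route `QuadraticBranchSignedControl` (rung K8, cell `bsd-potss`), residual crux
# `PlusEtaMainConjectureNonsurj` (stmt-BirchSwinnertonDyer-19606): TAMAGAWA-ROW RECORDS — the seven
# rank-`0` non-onto rows with `5 ∣ Tam(W)` below `5·10⁵`, file A (anchor `2700p1`: 78300bh1, 159300l1, 164700i1, 164700n1) («the OPEN in-table content of `stub_etaMC_r0_mu`»,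
# skeleton v4), each from the FINE ROAD + its DRS-certified CM anchor (seat `bsd-potss-k8eta-c2` g6)

WHAT. For each of the rows `78300bh1`, `159300l1`, `164700i1`, `164700n1` (anchor `2700p1`), `162675n1`, `404325f1`
(anchor `675a1`), `417600fp1` (anchor `14400l1`) — `W` the additive Gss2 partner at `p = 5`, `r_an(W) = 0`,
`#Ш(W)_an ∈ {1, 4}`, `5 ∣ Tam(W)`, `V = W^{(5)}` good supersingular with image `C_ns⁺(5)` — the record
`etaMC_r0_<label>_5` concludes Kobayashi's even main conjecture at `η`, `QuadraticBranchPlusEtaMainConjectureAt V 5`,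
for EVERY globally minimal model `V` of `W^{(5)}` good at `5` with `a_5(V) = 0`, from:
* IN THE KERNEL (`decide` on Cremona's coefficients): `Δ(W) ≠ 0`, global minimality of `W` (Silverman's criterion on
  the support of `Δ`, x11b's `isGloballyMinimal_of_krausCriterion_support`; every bad prime has `v(Δ) < 12` — at the
  multiplicative prime `v(Δ) = 5`, as the `C_ns⁺(5)` image forces), `Δ(anchor) ≠ 0`;
* NAMED PUBLISHED INPUTS (hypothesis position): `hPT`, `hmod`, `hGZK`, `h22`, `h41`, `hKO` (as ctrl g4 / g2) and `h6273`
  (Kobayashi 2003 Thm. 6.2/6.3/7.3 i)/Cor. 7.2 at `η` on pinned objects, k8q-c3 g6);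
* DISPLAYED per-row INPUTS: `L(W,1) ≠ 0` (`hLW`, Cremona `r_an = 0`), `#Ш(W)_an` (`hs`, Cremona allbsd), the mod-`5`
  congruence `W[5] ≅ W′[5]` with the anchor (`hcong`, Kraus–Oesterlé certificate kit j270119, g3), statement (A) for
  the ANCHOR at `5` in the cell's currency (`hA'` — certified by Deo–Ray–Sujatha 2023 Thm. 3.7 in census kit j277504
  modulo the ANALYTIC `#Ш(W′) = 1` and Cremona's generator of the rank-`1` CM anchor; PRINT + analytic input, not a
  tree theorem), and the analytic `μ(L_5⁺(V,η,X)) = 0` (`hμan`, PARI j269184, g3 P2);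
through part 3's `EtaFineRoad.quadraticBranchPlusEtaMainConjectureAt_of_congruent_conjA_of_shaAn_unit` (Lim–Sujatha transfer
PROVED; fine road; ctrl g4's converse road; L₀ trivial as `ord_5 #Ш(W)_an = 0`).

HONEST FRAMING (cell `bsd-potss`; FULL-BSD rank ≤ 1 programme, HUMAN RULING D-0036/D-0074): per-row RECORDS, CONDITIONAL
on the displayed named facts and the displayed per-row inputs listed above; no stub of 19606 is proved by name; the crux
stays OPEN; nothing is booked; `BSD(W,5)` is claimed for no pair. `--supports stmt-BirchSwinnertonDyer-19606`.

References: [Cremona1997] Table 1 (labels as listed); [Kobayashi2003] §4 (p. 8), Thm. 7.3 i) (p. 13); [LimSujatha2018]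
§3 Prop. 3.2; [DeoRaySujatha2023] Thm. 3.7; [KrausOesterle1992] Prop. 4; [SilvermanAEC2009] VII.1 Rem. 1.1.
-/

set_option autoImplicit false
set_option linter.dupNamespace false

noncomputable section

open scoped Classical

open CongruenceSubgroup Field WeierstrassCurve
open Literature.NumberTheory.EllipticCurves
open Literature.NumberTheory.EllipticCurves.ModularForms
open Literature.NumberTheory.EllipticCurves.Rank1Residual
open Literature.NumberTheory.GaloisRepresentations
open Literature.NumberTheory.GaloisCohomology
open Literature.NumberTheory.EllipticCurves.GreenbergVatsal2000
open Summit.BirchSwinnertonDyer.Rank1Residual.X11b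
open Summit.BirchSwinnertonDyer.Rank1Residual.Additive

namespace Summit.BirchSwinnertonDyer.BirchSwinnertonDyer.Theorems

namespace EtaFineRoadRecords

/-- `2700p1` = `[0, 0, 0, 0, 500]` (CM anchor): `Δ ≠ 0` (kernel). [cite: Cremona1997, Table 1 (label 2700p1)] -/
theorem isElliptic_2700p1 : (⟨0, 0, 0, 0, 500⟩ : WeierstrassCurve ℚ).IsElliptic :=
  isElliptic_of_discOf_ne_zero 0 0 0 0 500 (by decide +kernel)

/-- `78300bh1` = `[0, 0, 0, -705375, 135465750]`: `Δ ≠ 0` (kernel). [cite: Cremona1997, Table 1 (label 78300bh1)] -/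
theorem isElliptic_78300bh1 : (⟨0, 0, 0, (-705375), 135465750⟩ : WeierstrassCurve ℚ).IsElliptic :=
  isElliptic_of_discOf_ne_zero 0 0 0 (-705375) 135465750 (by decide +kernel)

set_option maxRecDepth 100000 in
/-- `78300bh1` is a global minimal equation (Silverman's criterion on the support of `Δ`, kernel; `v(Δ) < 12` at every bad
prime — `= 5` at the multiplicative one). [cite: SilvermanAEC2009, VII.1 Remark 1.1] -/
theorem isGloballyMinimal_78300bh1 : (⟨0, 0, 0, (-705375), 135465750⟩ : WeierstrassCurve ℚ).IsGloballyMinimal :=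
  isGloballyMinimal_of_krausCriterion_support 0 0 0 (-705375) 135465750 [(2, 2, 8), (3, 3, 11), (5, 2, 6), (29, 1, 5)]
    (by decide +kernel) (by decide +kernel) (by decide +kernel)

set_option maxRecDepth 100000 in
/-- **(C1⁺_η) at `p = 5` for every good `a_5 = 0` model `V` of the `5`-twist of `78300bh1`** (`N = 78300`; Cremona: `r_an = 0`,
`#Ш_an = 1`; `5 ∣ Tam` — a TAMAGAWA row of skeleton v4) from the fine road and the CM anchor `2700p1`: kernel `Δ ≠ 0` /
minimality; named facts `hPT hmod hGZK h22 h41 hKO h6273`; displayed `hLW`, `hs`, the congruence `hcong` with `2700p1`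
(KO92 j270119), (A) at the anchor `hA'` (DRS Thm. 3.7 certificate j277504 + analytic `#Ш(2700p1) = 1`), the analytic `μ`
(`hμan`, j269184). Per-row instance of `EtaFineRoad.quadraticBranchPlusEtaMainConjectureAt_of_congruent_conjA_of_shaAn_unit`;
CONDITIONAL; nothing booked. [cite: Kobayashi2003, §4 (p. 8)] [cite: LimSujatha2018, §3 Prop. 3.2]
[cite: DeoRaySujatha2023, Thm. 3.7] [cite: Cremona1997, Table 1 (label 78300bh1)] -/
theorem etaMC_r0_78300bh1_5 (hPT : poitouTate_selmerStructure_duality_real ℚ) (hmod : hasEntireLFunction_rat)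
    (hGZK : rank_eq_analyticRank_of_analyticRank_le_one)
    (h22 : Kobayashi2003.thm22_etaSignedSelmerDual_finite_torsion)
    (h41 : Kobayashi2003.thm41_plusEtaCharIdeal_dvd)
    (hKO : KitajimaOtsuki2018.mainThm13_etaSignedSelmerDual_noFiniteSubmodule)
    (h6273 : Kobayashi2003.thm62_63_73_etaColemanPoitouTate)
    (W : WeierstrassCurve ℚ) (hW : W = ⟨0, 0, 0, (-705375), 135465750⟩) (hLW : W.entireLFunction 1 ≠ 0)
    (hs : shaAn W = ((1 : ℕ) : ℚ))
    (W' : WeierstrassCurve ℚ) (hW' : W' = ⟨0, 0, 0, 0, 500⟩)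
    (hcong : ∃ e : W.geomTorsion ((5 : ℕ) : ℤ) ≃+ W'.geomTorsion ((5 : ℕ) : ℤ),
      ∀ (σ : absoluteGaloisGroup ℚ) (P : W.geomTorsion ((5 : ℕ) : ℤ)), e (σ • P) = σ • e P)
    (hA' : ∀ (κ : ZpExtension ℚ 5), κ.IsCyclotomic →
      ∃ (γ : absoluteGaloisGroup ℚ) (D : W'.FineSelmerDualData κ γ),
        Module.Finite ℤ_[5] (RestrictScalars ℤ_[5] (IwasawaAlgebra 5) D.X)) :
    ∀ (V : WeierstrassCurve ℚ) [V.IsElliptic] [V.IsGloballyMinimal] [Fact (5 : ℕ).Prime],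
      (∃ C : VariableChange ℚ, C • W.quadraticTwist (5) = V) →
      V.HasGoodReductionAtPrime 5 → V.frobeniusTrace 5 = 0 →
      (∀ {N : ℕ} [NeZero N] {f : CuspForm (Gamma0 N) 2}, IsNewformOf V f →
        ∀ (ϖ : ℚ), (if Even (5 / 2) then (ϖ : ℝ) * V.realPeriodRat = plusPeriod f
            else (ϖ : ℝ) * V.imaginaryPeriodRat = minusPeriod f) →
        ∀ (Lη : IwasawaAlgebra 5), IsQuadraticBranchPlusLFunction f 5 ϖ Lη → HasUnitContent Lη) →
        QuadraticBranchPlusEtaMainConjectureAt V 5 := by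
  subst hW; subst hW'
  intro V _ _ _ hC hgood hap hμan
  obtain ⟨C, hCV⟩ := hC
  haveI := isElliptic_78300bh1
  haveI := isGloballyMinimal_78300bh1
  haveI := isElliptic_2700p1
  have hD : ((-1 : ℚ) ^ ((5 : ℕ) / 2) * ((5 : ℕ) : ℚ)) = 5 := by norm_num
  exact EtaFineRoad.quadraticBranchPlusEtaMainConjectureAt_of_congruent_conjA_of_shaAn_unit _ 5 hPT hmod hGZK h22 h41
    hKO h6273 V C (le_refl 5) (by rw [hD]; exact hCV) hgood hap hLW (q := ((1 : ℕ) : ℚ)) (by exact_mod_cast hs) (by simp) _ hcong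
    hA' hμan

/-- `159300l1` = `[0, 0, 0, -121125, 12756625]`: `Δ ≠ 0` (kernel). [cite: Cremona1997, Table 1 (label 159300l1)] -/
theorem isElliptic_159300l1 : (⟨0, 0, 0, (-121125), 12756625⟩ : WeierstrassCurve ℚ).IsElliptic :=
  isElliptic_of_discOf_ne_zero 0 0 0 (-121125) 12756625 (by decide +kernel)

set_option maxRecDepth 100000 in
/-- `159300l1` is a global minimal equation (Silverman's criterion on the support of `Δ`, kernel; `v(Δ) < 12` at every bad
prime — `= 5` at the multiplicative one). [cite: SilvermanAEC2009, VII.1 Remark 1.1] -/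
theorem isGloballyMinimal_159300l1 : (⟨0, 0, 0, (-121125), 12756625⟩ : WeierstrassCurve ℚ).IsGloballyMinimal :=
  isGloballyMinimal_of_krausCriterion_support 0 0 0 (-121125) 12756625 [(2, 2, 4), (3, 3, 5), (5, 2, 6), (59, 1, 5)]
    (by decide +kernel) (by decide +kernel) (by decide +kernel)

set_option maxRecDepth 100000 in
/-- **(C1⁺_η) at `p = 5` for every good `a_5 = 0` model `V` of the `5`-twist of `159300l1`** (`N = 159300`; Cremona: `r_an = 0`,
`#Ш_an = 1`; `5 ∣ Tam` — a TAMAGAWA row of skeleton v4) from the fine road and the CM anchor `2700p1`: kernel `Δ ≠ 0` /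
minimality; named facts `hPT hmod hGZK h22 h41 hKO h6273`; displayed `hLW`, `hs`, the congruence `hcong` with `2700p1`
(KO92 j270119), (A) at the anchor `hA'` (DRS Thm. 3.7 certificate j277504 + analytic `#Ш(2700p1) = 1`), the analytic `μ`
(`hμan`, j269184). Per-row instance of `EtaFineRoad.quadraticBranchPlusEtaMainConjectureAt_of_congruent_conjA_of_shaAn_unit`;
CONDITIONAL; nothing booked. [cite: Kobayashi2003, §4 (p. 8)] [cite: LimSujatha2018, §3 Prop. 3.2]
[cite: DeoRaySujatha2023, Thm. 3.7] [cite: Cremona1997, Table 1 (label 159300l1)] -/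
theorem etaMC_r0_159300l1_5 (hPT : poitouTate_selmerStructure_duality_real ℚ) (hmod : hasEntireLFunction_rat)
    (hGZK : rank_eq_analyticRank_of_analyticRank_le_one)
    (h22 : Kobayashi2003.thm22_etaSignedSelmerDual_finite_torsion)
    (h41 : Kobayashi2003.thm41_plusEtaCharIdeal_dvd)
    (hKO : KitajimaOtsuki2018.mainThm13_etaSignedSelmerDual_noFiniteSubmodule)
    (h6273 : Kobayashi2003.thm62_63_73_etaColemanPoitouTate)
    (W : WeierstrassCurve ℚ) (hW : W = ⟨0, 0, 0, (-121125), 12756625⟩) (hLW : W.entireLFunction 1 ≠ 0)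
    (hs : shaAn W = ((1 : ℕ) : ℚ))
    (W' : WeierstrassCurve ℚ) (hW' : W' = ⟨0, 0, 0, 0, 500⟩)
    (hcong : ∃ e : W.geomTorsion ((5 : ℕ) : ℤ) ≃+ W'.geomTorsion ((5 : ℕ) : ℤ),
      ∀ (σ : absoluteGaloisGroup ℚ) (P : W.geomTorsion ((5 : ℕ) : ℤ)), e (σ • P) = σ • e P)
    (hA' : ∀ (κ : ZpExtension ℚ 5), κ.IsCyclotomic →
      ∃ (γ : absoluteGaloisGroup ℚ) (D : W'.FineSelmerDualData κ γ),
        Module.Finite ℤ_[5] (RestrictScalars ℤ_[5] (IwasawaAlgebra 5) D.X)) :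
    ∀ (V : WeierstrassCurve ℚ) [V.IsElliptic] [V.IsGloballyMinimal] [Fact (5 : ℕ).Prime],
      (∃ C : VariableChange ℚ, C • W.quadraticTwist (5) = V) →
      V.HasGoodReductionAtPrime 5 → V.frobeniusTrace 5 = 0 →
      (∀ {N : ℕ} [NeZero N] {f : CuspForm (Gamma0 N) 2}, IsNewformOf V f →
        ∀ (ϖ : ℚ), (if Even (5 / 2) then (ϖ : ℝ) * V.realPeriodRat = plusPeriod f
            else (ϖ : ℝ) * V.imaginaryPeriodRat = minusPeriod f) →
        ∀ (Lη : IwasawaAlgebra 5), IsQuadraticBranchPlusLFunction f 5 ϖ Lη → HasUnitContent Lη) →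
        QuadraticBranchPlusEtaMainConjectureAt V 5 := by
  subst hW; subst hW'
  intro V _ _ _ hC hgood hap hμan
  obtain ⟨C, hCV⟩ := hC
  haveI := isElliptic_159300l1
  haveI := isGloballyMinimal_159300l1
  haveI := isElliptic_2700p1
  have hD : ((-1 : ℚ) ^ ((5 : ℕ) / 2) * ((5 : ℕ) : ℚ)) = 5 := by norm_num
  exact EtaFineRoad.quadraticBranchPlusEtaMainConjectureAt_of_congruent_conjA_of_shaAn_unit _ 5 hPT hmod hGZK h22 h41
    hKO h6273 V C (le_refl 5) (by rw [hD]; exact hCV) hgood hap hLW (q := ((1 : ℕ) : ℚ)) (by exact_mod_cast hs) (by simp) _ hcong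
    hA' hμan

/-- `164700i1` = `[0, 0, 0, -119963625, -505734387375]`: `Δ ≠ 0` (kernel). [cite: Cremona1997, Table 1 (label 164700i1)] -/
theorem isElliptic_164700i1 : (⟨0, 0, 0, (-119963625), (-505734387375)⟩ : WeierstrassCurve ℚ).IsElliptic :=
  isElliptic_of_discOf_ne_zero 0 0 0 (-119963625) (-505734387375) (by decide +kernel)

set_option maxRecDepth 100000 in
/-- `164700i1` is a global minimal equation (Silverman's criterion on the support of `Δ`, kernel; `v(Δ) < 12` at every bad
prime — `= 5` at the multiplicative one). [cite: SilvermanAEC2009, VII.1 Remark 1.1] -/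
theorem isGloballyMinimal_164700i1 : (⟨0, 0, 0, (-119963625), (-505734387375)⟩ : WeierstrassCurve ℚ).IsGloballyMinimal :=
  isGloballyMinimal_of_krausCriterion_support 0 0 0 (-119963625) (-505734387375) [(2, 2, 4), (3, 3, 3), (5, 2, 6), (61, 1, 5)]
    (by decide +kernel) (by decide +kernel) (by decide +kernel)

set_option maxRecDepth 100000 in
/-- **(C1⁺_η) at `p = 5` for every good `a_5 = 0` model `V` of the `5`-twist of `164700i1`** (`N = 164700`; Cremona: `r_an = 0`,
`#Ш_an = 1`; `5 ∣ Tam` — a TAMAGAWA row of skeleton v4) from the fine road and the CM anchor `2700p1`: kernel `Δ ≠ 0` /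
minimality; named facts `hPT hmod hGZK h22 h41 hKO h6273`; displayed `hLW`, `hs`, the congruence `hcong` with `2700p1`
(KO92 j270119), (A) at the anchor `hA'` (DRS Thm. 3.7 certificate j277504 + analytic `#Ш(2700p1) = 1`), the analytic `μ`
(`hμan`, j269184). Per-row instance of `EtaFineRoad.quadraticBranchPlusEtaMainConjectureAt_of_congruent_conjA_of_shaAn_unit`;
CONDITIONAL; nothing booked. [cite: Kobayashi2003, §4 (p. 8)] [cite: LimSujatha2018, §3 Prop. 3.2]
[cite: DeoRaySujatha2023, Thm. 3.7] [cite: Cremona1997, Table 1 (label 164700i1)] -/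
theorem etaMC_r0_164700i1_5 (hPT : poitouTate_selmerStructure_duality_real ℚ) (hmod : hasEntireLFunction_rat)
    (hGZK : rank_eq_analyticRank_of_analyticRank_le_one)
    (h22 : Kobayashi2003.thm22_etaSignedSelmerDual_finite_torsion)
    (h41 : Kobayashi2003.thm41_plusEtaCharIdeal_dvd)
    (hKO : KitajimaOtsuki2018.mainThm13_etaSignedSelmerDual_noFiniteSubmodule)
    (h6273 : Kobayashi2003.thm62_63_73_etaColemanPoitouTate)
    (W : WeierstrassCurve ℚ) (hW : W = ⟨0, 0, 0, (-119963625), (-505734387375)⟩) (hLW : W.entireLFunction 1 ≠ 0)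
    (hs : shaAn W = ((1 : ℕ) : ℚ))
    (W' : WeierstrassCurve ℚ) (hW' : W' = ⟨0, 0, 0, 0, 500⟩)
    (hcong : ∃ e : W.geomTorsion ((5 : ℕ) : ℤ) ≃+ W'.geomTorsion ((5 : ℕ) : ℤ),
      ∀ (σ : absoluteGaloisGroup ℚ) (P : W.geomTorsion ((5 : ℕ) : ℤ)), e (σ • P) = σ • e P)
    (hA' : ∀ (κ : ZpExtension ℚ 5), κ.IsCyclotomic →
      ∃ (γ : absoluteGaloisGroup ℚ) (D : W'.FineSelmerDualData κ γ),
        Module.Finite ℤ_[5] (RestrictScalars ℤ_[5] (IwasawaAlgebra 5) D.X)) :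
    ∀ (V : WeierstrassCurve ℚ) [V.IsElliptic] [V.IsGloballyMinimal] [Fact (5 : ℕ).Prime],
      (∃ C : VariableChange ℚ, C • W.quadraticTwist (5) = V) →
      V.HasGoodReductionAtPrime 5 → V.frobeniusTrace 5 = 0 →
      (∀ {N : ℕ} [NeZero N] {f : CuspForm (Gamma0 N) 2}, IsNewformOf V f →
        ∀ (ϖ : ℚ), (if Even (5 / 2) then (ϖ : ℝ) * V.realPeriodRat = plusPeriod f
            else (ϖ : ℝ) * V.imaginaryPeriodRat = minusPeriod f) →
        ∀ (Lη : IwasawaAlgebra 5), IsQuadraticBranchPlusLFunction f 5 ϖ Lη → HasUnitContent Lη) →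
        QuadraticBranchPlusEtaMainConjectureAt V 5 := by
  subst hW; subst hW'
  intro V _ _ _ hC hgood hap hμan
  obtain ⟨C, hCV⟩ := hC
  haveI := isElliptic_164700i1
  haveI := isGloballyMinimal_164700i1
  haveI := isElliptic_2700p1
  have hD : ((-1 : ℚ) ^ ((5 : ℕ) / 2) * ((5 : ℕ) : ℚ)) = 5 := by norm_num
  exact EtaFineRoad.quadraticBranchPlusEtaMainConjectureAt_of_congruent_conjA_of_shaAn_unit _ 5 hPT hmod hGZK h22 h41
    hKO h6273 V C (le_refl 5) (by rw [hD]; exact hCV) hgood hap hLW (q := ((1 : ℕ) : ℚ)) (by exact_mod_cast hs) (by simp) _ hcong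
    hA' hμan

/-- `164700n1` = `[0, 0, 0, -1079672625, 13654828459125]`: `Δ ≠ 0` (kernel). [cite: Cremona1997, Table 1 (label 164700n1)] -/
theorem isElliptic_164700n1 : (⟨0, 0, 0, (-1079672625), 13654828459125⟩ : WeierstrassCurve ℚ).IsElliptic :=
  isElliptic_of_discOf_ne_zero 0 0 0 (-1079672625) 13654828459125 (by decide +kernel)

set_option maxRecDepth 100000 in
/-- `164700n1` is a global minimal equation (Silverman's criterion on the support of `Δ`, kernel; `v(Δ) < 12` at every bad
prime — `= 5` at the multiplicative one). [cite: SilvermanAEC2009, VII.1 Remark 1.1] -/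
theorem isGloballyMinimal_164700n1 : (⟨0, 0, 0, (-1079672625), 13654828459125⟩ : WeierstrassCurve ℚ).IsGloballyMinimal :=
  isGloballyMinimal_of_krausCriterion_support 0 0 0 (-1079672625) 13654828459125 [(2, 2, 4), (3, 3, 9), (5, 2, 6), (61, 1, 5)]
    (by decide +kernel) (by decide +kernel) (by decide +kernel)

set_option maxRecDepth 100000 in
/-- **(C1⁺_η) at `p = 5` for every good `a_5 = 0` model `V` of the `5`-twist of `164700n1`** (`N = 164700`; Cremona: `r_an = 0`,
`#Ш_an = 1`; `5 ∣ Tam` — a TAMAGAWA row of skeleton v4) from the fine road and the CM anchor `2700p1`: kernel `Δ ≠ 0` /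
minimality; named facts `hPT hmod hGZK h22 h41 hKO h6273`; displayed `hLW`, `hs`, the congruence `hcong` with `2700p1`
(KO92 j270119), (A) at the anchor `hA'` (DRS Thm. 3.7 certificate j277504 + analytic `#Ш(2700p1) = 1`), the analytic `μ`
(`hμan`, j269184). Per-row instance of `EtaFineRoad.quadraticBranchPlusEtaMainConjectureAt_of_congruent_conjA_of_shaAn_unit`;
CONDITIONAL; nothing booked. [cite: Kobayashi2003, §4 (p. 8)] [cite: LimSujatha2018, §3 Prop. 3.2]
[cite: DeoRaySujatha2023, Thm. 3.7] [cite: Cremona1997, Table 1 (label 164700n1)] -/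
theorem etaMC_r0_164700n1_5 (hPT : poitouTate_selmerStructure_duality_real ℚ) (hmod : hasEntireLFunction_rat)
    (hGZK : rank_eq_analyticRank_of_analyticRank_le_one)
    (h22 : Kobayashi2003.thm22_etaSignedSelmerDual_finite_torsion)
    (h41 : Kobayashi2003.thm41_plusEtaCharIdeal_dvd)
    (hKO : KitajimaOtsuki2018.mainThm13_etaSignedSelmerDual_noFiniteSubmodule)
    (h6273 : Kobayashi2003.thm62_63_73_etaColemanPoitouTate)
    (W : WeierstrassCurve ℚ) (hW : W = ⟨0, 0, 0, (-1079672625), 13654828459125⟩) (hLW : W.entireLFunction 1 ≠ 0)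
    (hs : shaAn W = ((1 : ℕ) : ℚ))
    (W' : WeierstrassCurve ℚ) (hW' : W' = ⟨0, 0, 0, 0, 500⟩)
    (hcong : ∃ e : W.geomTorsion ((5 : ℕ) : ℤ) ≃+ W'.geomTorsion ((5 : ℕ) : ℤ),
      ∀ (σ : absoluteGaloisGroup ℚ) (P : W.geomTorsion ((5 : ℕ) : ℤ)), e (σ • P) = σ • e P)
    (hA' : ∀ (κ : ZpExtension ℚ 5), κ.IsCyclotomic →
      ∃ (γ : absoluteGaloisGroup ℚ) (D : W'.FineSelmerDualData κ γ),
        Module.Finite ℤ_[5] (RestrictScalars ℤ_[5] (IwasawaAlgebra 5) D.X)) :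
    ∀ (V : WeierstrassCurve ℚ) [V.IsElliptic] [V.IsGloballyMinimal] [Fact (5 : ℕ).Prime],
      (∃ C : VariableChange ℚ, C • W.quadraticTwist (5) = V) →
      V.HasGoodReductionAtPrime 5 → V.frobeniusTrace 5 = 0 →
      (∀ {N : ℕ} [NeZero N] {f : CuspForm (Gamma0 N) 2}, IsNewformOf V f →
        ∀ (ϖ : ℚ), (if Even (5 / 2) then (ϖ : ℝ) * V.realPeriodRat = plusPeriod f
            else (ϖ : ℝ) * V.imaginaryPeriodRat = minusPeriod f) →
        ∀ (Lη : IwasawaAlgebra 5), IsQuadraticBranchPlusLFunction f 5 ϖ Lη → HasUnitContent Lη) →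
        QuadraticBranchPlusEtaMainConjectureAt V 5 := by
  subst hW; subst hW'
  intro V _ _ _ hC hgood hap hμan
  obtain ⟨C, hCV⟩ := hC
  haveI := isElliptic_164700n1
  haveI := isGloballyMinimal_164700n1
  haveI := isElliptic_2700p1
  have hD : ((-1 : ℚ) ^ ((5 : ℕ) / 2) * ((5 : ℕ) : ℚ)) = 5 := by norm_num
  exact EtaFineRoad.quadraticBranchPlusEtaMainConjectureAt_of_congruent_conjA_of_shaAn_unit _ 5 hPT hmod hGZK h22 h41
    hKO h6273 V C (le_refl 5) (by rw [hD]; exact hCV) hgood hap hLW (q := ((1 : ℕ) : ℚ)) (by exact_mod_cast hs) (by simp) _ hcong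
    hA' hμan

end EtaFineRoadRecords

end Summit.BirchSwinnertonDyer.BirchSwinnertonDyer.Theorems

end
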